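import Literature.Claims.NS.Chio2026
import HarnessLib

/-!
# Solo salvage for claim C55 `Chio2026` (cell `ns-claims`, D-0090): the TRUE pointwise energy
# transport identity behind §3.1's display, and the exact defect of the printed display

Claim skeleton: `Literature/Claims/NS/Chio2026.lean` (typist-10, p479182; lead RULING v1.29e).
Its `EnergyTransport_pt` / `Step_0` type the printed display (§3.1 p.4, l.103–114)

  `∂ₜE + u·∇E = −ν|∇u|²`,  `E = ½|u|² + p`,

«derived» by dotting the momentum equation with `u`. What dotting the momentum equation
`∂ₜu + (u·∇)u = −∇p + νΔu` with `u` actually gives, POINTWISE and with no use of `∇·u = 0`, is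

  `∂ₜ(½|u|²) + u·∇(½|u|² + p) = ν ⟪u, Δu⟫`      (`energyTransport_true`)

— the time derivative falls on the kinetic part only, and the viscous term is `ν u·Δu`, not `−ν|∇u|²`
(the two differ by `νΔ(½|u|²) = ν(u·Δu + |∇u|²)`, a divergence that disappears only after integration
over a region with no boundary flux). In the skeleton's vocabulary (`mechE`, `critQ`, `gradSq`,
`timeDerivWithin`) this file proves:

* `critQ_eq` — `u·∇E = ⟪u, (u·∇)u⟫ + ⟪∇p, u⟫`;
* `timeDerivWithin_mechE` — `∂ₜE = ⟪u, ∂ₜu⟫ + ∂ₜp` (one-sided, within the time set);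
* `energyTransport_true` — the correct identity above, from the momentum equation at ONE point;
* `printedDisplay_iff_defect` — at such a point the PRINTED display holds iff
  `∂ₜp + ν(⟪u, Δu⟫ + |∇u|²) = 0`; so any classical solution with, at one point, `∂ₜp ≠ −νΔ(½|u|²)`
  refutes `EnergyTransport_pt` (e.g. a steady linear strain flow `u = Sx`, `p = −½⟪x, S²x⟫`,
  `S = diag(1,1,−2)`: `∂ₜp = 0`, `⟪u,Δu⟫ = 0`, `|∇u|² = |S|² = 6` — `LinearFlow.isClassicalNSSolutionOn`,
  NEG-TOOLKIT T9; the kill itself is the refuter's lane).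

Everything here is TRUE mathematics (pointwise calculus); nothing asserts a step of the claim. Salvage
seat ns-claims-salvage-p5 g2 (NEG family). Solo lane (`Theorems/SoloSalvage<Slug>.lean`, no item).

WHAT THIS IS NOT: not a claim about NS regularity or blow-up; not a claim about any author beyond the
typed locator.
-/

-- lint debt (one line): the Theorems namespace `Summit.NavierStokesRegularity.NavierStokesRegularity.…` repeats
-- the summit name by the D-0017 layout (single-conjunct summit), as in every sibling Solo file.
set_option linter.dupNamespace false

noncomputable section

open Set Function
open scoped ContDiff Laplacian InnerProductSpace RealInnerProductSpace

namespace Summit.NavierStokesRegularity.NavierStokesRegularity.Theorems.Chio2026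

open Literature.Analysis.FluidPDE
open Literature.Claims.NS.Chio2026

/-! ### The two pieces of the printed left-hand side -/

/-- **`u·∇E = ⟪u, (u·∇)u⟫ + ⟪∇p, u⟫`** at a point where the slices are differentiable
(`critQ u p t x = D(½|u|² + p)(x)[u(t,x)]`). [cite: Chio2026WeakSingularity, §3.1 p.4] -/
theorem critQ_eq {u : ℝ → E3 → E3} {p : ℝ → E3 → ℝ} {t : ℝ} {x : E3}
    (hu : DifferentiableAt ℝ (u t) x) (hp : DifferentiableAt ℝ (p t) x) :
    critQ u p t x = ⟪u t x, convect (u t) (u t) x⟫ + ⟪gradient (p t) x, u t x⟫ := by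
  unfold critQ
  have hmech : mechE u p t = fun y => (1 / 2 : ℝ) * ‖u t y‖ ^ 2 + p t y := rfl
  have h1 : HasFDerivAt (fun y => ‖u t y‖ ^ 2) (2 • (innerSL ℝ (u t x)).comp (fderiv ℝ (u t) x)) x :=
    hu.hasFDerivAt.norm_sq
  have h2 : HasFDerivAt (fun y => (1 / 2 : ℝ) * ‖u t y‖ ^ 2)
      ((1 / 2 : ℝ) • (2 • (innerSL ℝ (u t x)).comp (fderiv ℝ (u t) x))) x := h1.const_mul (1 / 2)
  have h3 : HasFDerivAt (mechE u p t)
      ((1 / 2 : ℝ) • (2 • (innerSL ℝ (u t x)).comp (fderiv ℝ (u t) x)) + fderiv ℝ (p t) x) x := by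
    rw [hmech]; exact h2.add hp.hasFDerivAt
  rw [h3.fderiv, convect_apply]
  have hg : fderiv ℝ (p t) x (u t x) = ⟪gradient (p t) x, u t x⟫ := by
    rw [gradient, InnerProductSpace.toDual_symm_apply]
  simp only [_root_.add_apply, FunLike.coe_smul, Pi.smul_apply,
    ContinuousLinearMap.comp_apply, innerSL_apply_apply, smul_eq_mul, hg]
  ring

/-- **`∂ₜE = ⟪u, ∂ₜu⟫ + ∂ₜp`** (one-sided time derivative within `S`, at a point of unique
differentiability where both slices are time-differentiable). [cite: Chio2026WeakSingularity, §3.1 p.4] -/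
theorem timeDerivWithin_mechE {u : ℝ → E3 → E3} {p : ℝ → E3 → ℝ} {S : Set ℝ} {t : ℝ} {x : E3}
    (hS : UniqueDiffWithinAt ℝ S t) (hu : DifferentiableWithinAt ℝ (fun s => u s x) S t)
    (hp : DifferentiableWithinAt ℝ (fun s => p s x) S t) :
    timeDerivWithin S (mechE u p) t x =
      ⟪u t x, timeDerivWithin S u t x⟫ + timeDerivWithin S p t x := by
  simp only [timeDerivWithin_apply]
  have h1 : HasDerivWithinAt (fun s => ‖u s x‖ ^ 2)
      (2 * ⟪u t x, derivWithin (fun s => u s x) S t⟫) S t := hu.hasDerivWithinAt.norm_sq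
  have h2 := ((h1.const_mul (1 / 2 : ℝ)).add hp.hasDerivWithinAt).derivWithin hS
  have hfun : (fun s => mechE u p s x) = fun s => (1 / 2 : ℝ) * ‖u s x‖ ^ 2 + p s x := rfl
  rw [hfun]
  rw [show (fun s => (1 / 2 : ℝ) * ‖u s x‖ ^ 2 + p s x) =
      ((fun s => (1 / 2 : ℝ) * ‖u s x‖ ^ 2) + fun s => p s x) from rfl, h2]
  ring

/-- **`∂ₜ(½|u|²) = ⟪u, ∂ₜu⟫`** (one-sided, within `S`). [folklore] -/
theorem timeDerivWithin_kinetic {u : ℝ → E3 → E3} {S : Set ℝ} {t : ℝ} {x : E3}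
    (hS : UniqueDiffWithinAt ℝ S t) (hu : DifferentiableWithinAt ℝ (fun s => u s x) S t) :
    timeDerivWithin S (fun s y => (1 / 2 : ℝ) * ‖u s y‖ ^ 2) t x = ⟪u t x, timeDerivWithin S u t x⟫ := by
  simp only [timeDerivWithin_apply]
  have h1 : HasDerivWithinAt (fun s => ‖u s x‖ ^ 2)
      (2 * ⟪u t x, derivWithin (fun s => u s x) S t⟫) S t := hu.hasDerivWithinAt.norm_sq
  rw [(h1.const_mul (1 / 2 : ℝ)).derivWithin hS]
  ring

/-! ### The true identity and the defect of the printed display -/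

/-- **The TRUE pointwise energy transport identity.** If the momentum equation
`∂ₜu + (u·∇)u = −∇p + νΔu` holds at `(t, x)` (slices differentiable there, `t` a point of unique
differentiability of the time set `S`), then

  `∂ₜ(½|u|²) + u·∇(½|u|² + p) = ν ⟪u, Δu⟫`  at `(t, x)`.

No incompressibility is needed. This is what «taking the dot product of the NS momentum equation with
the velocity field u» (§3.1 p.4) yields; the printed display replaces `∂ₜ(½|u|²)` by `∂ₜ(½|u|² + p)`
and `ν u·Δu` by `−ν|∇u|²`. [cite: Chio2026WeakSingularity, §3.1 p.4 (l.103–114)] -/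
theorem energyTransport_true {ν : ℝ} {u : ℝ → E3 → E3} {p : ℝ → E3 → ℝ} {S : Set ℝ} {t : ℝ} {x : E3}
    (hS : UniqueDiffWithinAt ℝ S t) (hu : DifferentiableAt ℝ (u t) x) (hp : DifferentiableAt ℝ (p t) x)
    (hut : DifferentiableWithinAt ℝ (fun s => u s x) S t)
    (hmom : timeDerivWithin S u t x + convect (u t) (u t) x = -gradient (p t) x + ν • Δ (u t) x) :
    timeDerivWithin S (fun s y => (1 / 2 : ℝ) * ‖u s y‖ ^ 2) t x + critQ u p t x =
      ν * ⟪u t x, Δ (u t) x⟫ := by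
  rw [timeDerivWithin_kinetic hS hut, critQ_eq hu hp]
  have h : timeDerivWithin S u t x = -gradient (p t) x + ν • Δ (u t) x - convect (u t) (u t) x :=
    eq_sub_of_add_eq hmom
  rw [h, inner_sub_right, inner_add_right, inner_neg_right, inner_smul_right, real_inner_comm (u t x)]
  ring

/-- **The defect of the printed display.** At a point where the momentum equation holds (as in
`energyTransport_true`, with the pressure slice also time-differentiable), the PRINTED display
`∂ₜE + u·∇E = −ν|∇u|²` (`E = ½|u|² + p`) holds if and only if `∂ₜp + ν(⟪u, Δu⟫ + |∇u|²) = 0` there —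
i.e. iff `∂ₜp = −νΔ(½|u|²)` at that point. [cite: Chio2026WeakSingularity, §3.1 p.4 (l.109–114)] -/
theorem printedDisplay_iff_defect {ν : ℝ} {u : ℝ → E3 → E3} {p : ℝ → E3 → ℝ} {S : Set ℝ} {t : ℝ}
    {x : E3} (hS : UniqueDiffWithinAt ℝ S t) (hu : DifferentiableAt ℝ (u t) x)
    (hp : DifferentiableAt ℝ (p t) x) (hut : DifferentiableWithinAt ℝ (fun s => u s x) S t)
    (hpt : DifferentiableWithinAt ℝ (fun s => p s x) S t)
    (hmom : timeDerivWithin S u t x + convect (u t) (u t) x = -gradient (p t) x + ν • Δ (u t) x) :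
    (timeDerivWithin S (mechE u p) t x + critQ u p t x = -ν * gradSq (u t) x) ↔
      timeDerivWithin S p t x + ν * (⟪u t x, Δ (u t) x⟫ + gradSq (u t) x) = 0 := by
  have hE := energyTransport_true hS hu hp hut hmom
  rw [timeDerivWithin_kinetic hS hut] at hE
  rw [timeDerivWithin_mechE hS hut hpt]
  constructor <;> intro h <;> linarith

/-- **Consequence for the typed Step 0 at its derivation grain**: `EnergyTransport_pt` implies that along
every pair `(u, p)` as there, `∂ₜp + ν(⟪u, Δu⟫ + |∇u|²) = 0` holds wherever the momentum equation and
`∇·u = 0` hold — the refuter's target is any classical solution violating this at one point.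
[cite: Chio2026WeakSingularity, §3.1 p.4] -/
theorem defect_of_energyTransport_pt (h : EnergyTransport_pt) {ν : ℝ} (hν : 0 < ν) {S : Set ℝ}
    {u : ℝ → E3 → E3} {p : ℝ → E3 → ℝ} {t : ℝ} {x : E3} (ht : t ∈ S) (hS : UniqueDiffWithinAt ℝ S t)
    (hu : ContDiff ℝ ∞ (u t)) (hp : ContDiff ℝ ∞ (p t))
    (hut : DifferentiableWithinAt ℝ (fun s => u s x) S t)
    (hpt : DifferentiableWithinAt ℝ (fun s => p s x) S t)
    (hmom : timeDerivWithin S u t x + convect (u t) (u t) x = -gradient (p t) x + ν • Δ (u t) x)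
    (hdiv : VectorCalculus.divergence (u t) x = 0) :
    timeDerivWithin S p t x + ν * (⟪u t x, Δ (u t) x⟫ + gradSq (u t) x) = 0 := by
  have hprinted := h ν hν S u p t x ht hu hp hut hpt hmom hdiv
  have hu1 : DifferentiableAt ℝ (u t) x := (hu.differentiable (by simp)).differentiableAt
  have hp1 : DifferentiableAt ℝ (p t) x := (hp.differentiable (by simp)).differentiableAt
  exact (printedDisplay_iff_defect hS hu1 hp1 hut hpt hmom).1 hprinted

end Summit.NavierStokesRegularity.NavierStokesRegularity.Theorems.Chio2026

end
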